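import Mathlib
import Summits.PneNP.PneNP.Theorems.ConvexRankGatesConvexGateBlindCodimension
import Summits.PneNP.PneNP.Theorems.ConvexRankGatesConvexGateBlindColumnSpaceHalfUnconditional

/-!
# PneNP / ConvexRankGates — `ConvexGateBlind`: ε-sensitivity costs an UNBOUNDED number of terms (`R ≥ C(m,2) + p`, every `p`)

Helpers (`--supports stmt-PneNP-10680`), COLUMN-SPACE line (prover seat 2, session 23) — eventual forms of the codimension
theorem (`…Codimension.codim_terms_lower_bound_of_catch`) for UNRESTRICTED non-negative factorisations of the LP slice of
the crux, `k = ⌈m^δ⌉₊`, every `δ ∈ (0, 1/2)`: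

* `lpSlice_codim_gt` (registered `lpSlice_codimension`) — **for every `p` and `c`, eventually in `m`, for every `ε > 0` and
  every `R ≤ m^c`: no non-negative factorisation `cdist Q u − ε = ∑_{l<R} U_l(u)V_l(Q)` whose row objects have codimension
  defect `≤ p` over the column space (every `p + 1` of the `V_l` have a non-trivial combination that is a clique sum on
  `k`-sets) exists.** Polynomial-size LP refutations must use row objects spanning MORE THAN ANY CONSTANT number of
  directions outside the column space `span{Q ↦ [e ⊆ Q]}` (`p = 0` is the column-space theorem itself).
* `lpSlice_terms_gt_choose_two_add` (registered `lpSlice_rank_plus`) — **for every `p`, eventually in `m`, for every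
  `ε > 0`: every non-negative factorisation of the LP slice has MORE than `C(m,2) + p` terms** (`rk₊(D − εJ) − rk(D) → ∞`;
  session 13 had `p = 0`, i.e. `rank + 1`). A factorisation with `R ≤ C(m,2) + p` terms has codimension defect `≤ p`
  (`exists_relation_of_card_le`, a finrank count: `W ⊕ span` of `p+1` unrelated row objects would have dimension
  `C(m,2) + p + 1 > R ≥ dim span{V_l}`), so the first theorem applies.
* `lpSlice_factorRank_gt` (registered `lpSlice_factor_rank_plus`) — the same with `#terms` replaced by the RANK OF THE
  RIGHT FACTOR: every polynomial-size factorisation has `rank(V|_{k-sets}) > C(m,2) + p` (it is `p`-far from a restricted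
  NMF in the sense of Gillis–Glineur), every `p`, eventually.
* `not_coneFactorisable_le_choose_two_add` — the same in the `ConeFactorisable` vocabulary of the strict-rank line.
[new]
-/

set_option linter.dupNamespace false

namespace Summit.PneNP.PneNP.Theorems

open Finset Real Filter Literature.Computability.Complexity
open Summit.PneNP.PneNP.Cruxes.ConvexGateBlind.StrictRankConicCover (Edge cdist)

noncomputable section

variable {m : ℕ}

/-! ## Few terms force a small codimension defect -/

/-- **Factor rank `≤ C(m,2) + p` ⟹ codimension defect `≤ p`.** If `cdist Q u − ε = ∑_{l<R} U_l(u) V_l(Q)` for all `k`-sets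
`Q` and all `k`-clique-free `u` (`3 ≤ k`, `k + 2 ≤ m`) and the row objects (restricted to `k`-sets) span at most `C(m,2) + p`
dimensions, then every `p + 1` of them have a non-trivial linear combination which is a clique sum `t(E(Q))` on `k`-sets.
(The column space `X(ℝ^E)` has dimension `C(m,2)` and lies in `span{V_l}`; `p + 1` row objects independent modulo it
would span, with it, `C(m,2) + p + 1` dimensions.) [new] -/
theorem exists_relation_of_finrank_le {k R p : ℕ} (hk : 3 ≤ k) (hkm : k + 2 ≤ m) (ε : ℝ)
    (U : (Edge m → Bool) → Fin R → ℝ) (V : Fin R → Finset (Fin m) → ℝ)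
    (hfact : ∀ (Q : Finset (Fin m)) (u : Edge m → Bool), Q.card = k → cliqueFn m k u = false →
      cdist Q u - ε = ∑ l, U u l * V l Q)
    (hfrV : Module.finrank ℝ (Submodule.span ℝ (Set.range fun l : Fin R =>
      fun Q : {Q : Finset (Fin m) // Q.card = k} => V l Q.1)) ≤ m.choose 2 + p)
    (s : Finset (Fin R)) (hs : s.card = p + 1) :
    ∃ h : Fin R → ℝ, (∀ l, l ∉ s → h l = 0) ∧ h ≠ 0 ∧
      ∃ t : Edge m → ℝ, ∀ Q : Finset (Fin m), Q.card = k →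
        ∑ l, h l * V l Q = ∑ e, (if cliqueVec Q e = true then t e else 0) := by
  classical
  -- the pair-inclusion map on `k`-sets (as in `exists_edgeWeighting_of_card_le`)
  set X : (Edge m → ℝ) →ₗ[ℝ] ({Q : Finset (Fin m) // Q.card = k} → ℝ) :=
    { toFun := fun t Q => ∑ e, (if cliqueVec Q.1 e = true then t e else 0)
      map_add' := fun t t' => by
        funext Q
        simp only [Pi.add_apply, ← Finset.sum_add_distrib]
        exact Finset.sum_congr rfl fun e _ => by split_ifs <;> simp
      map_smul' := fun a t => by
        funext Q
        simp only [Pi.smul_apply, smul_eq_mul, RingHom.id_apply, Finset.mul_sum]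
        exact Finset.sum_congr rfl fun e _ => by split_ifs <;> simp } with hX
  have hXapply : ∀ (t : Edge m → ℝ) (Q : {Q : Finset (Fin m) // Q.card = k}),
      X t Q = ∑ e, (if cliqueVec Q.1 e = true then t e else 0) := fun t Q => rfl
  have hXinj : Function.Injective X := by
    intro t t' h
    have h0 := eq_zero_of_cliqueSum_eq_zero (k := k) (by omega) hkm (t - t') fun Q hQ => by
      have h' := congrFun h ⟨Q, hQ⟩
      rw [hXapply, hXapply] at h'
      rw [← sub_eq_zero, ← Finset.sum_sub_distrib] at h'
      refine Eq.trans (Finset.sum_congr rfl fun e _ => ?_) h'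
      simp only [Pi.sub_apply]
      split_ifs <;> simp
    exact sub_eq_zero.1 h0
  set Vf : Fin R → ({Q : Finset (Fin m) // Q.card = k} → ℝ) := fun l Q => V l Q.1 with hVf
  set S : Submodule ℝ ({Q : Finset (Fin m) // Q.card = k} → ℝ) := Submodule.span ℝ (Set.range Vf) with hS
  have hVmem : ∀ l : Fin R, Vf l ∈ S := fun l => Submodule.subset_span ⟨l, rfl⟩
  have hcol : ∀ u : Edge m → Bool, cliqueFn m k u = false →
      (fun Q : {Q : Finset (Fin m) // Q.card = k} => cdist Q.1 u - ε) ∈ S := by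
    intro u hu
    have : (fun Q : {Q : Finset (Fin m) // Q.card = k} => cdist Q.1 u - ε) = ∑ l, U u l • Vf l := by
      funext Q
      rw [hfact Q.1 u Q.2 hu, Finset.sum_apply]
      rfl
    rw [this]
    exact Submodule.sum_mem _ fun l _ => Submodule.smul_mem _ _ (hVmem l)
  have hrange : LinearMap.range X ≤ S := by
    rintro _ ⟨t, rfl⟩
    rw [← Finset.univ_sum_single t, map_sum]
    refine Submodule.sum_mem _ fun e _ => ?_
    have hse : Pi.single e (t e) = t e • (Pi.single e (1 : ℝ) : Edge m → ℝ) := by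
      rw [← Pi.single_smul, smul_eq_mul, mul_one]
    rw [hse, LinearMap.map_smul]
    refine Submodule.smul_mem _ _ ?_
    have hXe : X (Pi.single e (1 : ℝ)) = (fun Q : {Q : Finset (Fin m) // Q.card = k} => cdist Q.1 (fun _ => false) - ε) -
        (fun Q => cdist Q.1 (fun f => decide (f = e)) - ε) := by
      funext Q
      rw [Pi.sub_apply, hXapply, sub_sub_sub_cancel_right, cdist_empty_sub_cdist_single, Finset.sum_eq_single e]
      · simp
      · intro f _ hfe; rw [Pi.single_eq_of_ne hfe]; simp
      · intro h; exact absurd (Finset.mem_univ e) h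
    rw [hXe]
    exact Submodule.sub_mem _ (hcol _ (cliqueFn_empty_eq_false hk)) (hcol _ (cliqueFn_single_eq_false hk e))
  have hfr : Module.finrank ℝ (LinearMap.range X) = m.choose 2 := by
    rw [LinearMap.finrank_range_of_inj hXinj, Module.finrank_fintype_fun_eq_card,
      Literature.Computability.Complexity.card_edgeSet_top_fin]
  have hfS : Module.finrank ℝ S ≤ m.choose 2 + p := hfrV
  -- suppose the `p + 1` row objects indexed by `s` are unrelated modulo the column space
  by_contra H
  push Not at H
  -- extension by zero of coefficient vectors on `s`
  set ext : (↥s → ℝ) → Fin R → ℝ := fun g l => if hl : l ∈ s then g ⟨l, hl⟩ else 0 with hext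
  have hext_off : ∀ g l, l ∉ s → ext g l = 0 := fun g l hl => by simp [hext, hl]
  have hext_sum : ∀ g : ↥s → ℝ, ∑ l, ext g l • Vf l = ∑ i : ↥s, g i • Vf i.1 := by
    intro g
    rw [← Finset.sum_filter_add_sum_filter_not Finset.univ (fun l : Fin R => l ∈ s)]
    rw [Finset.sum_eq_zero (s := Finset.univ.filter fun l : Fin R => ¬ l ∈ s) fun l hl => by
      rw [Finset.mem_filter] at hl; rw [hext_off g l hl.2, zero_smul], add_zero]
    have hfs : (Finset.univ.filter fun l : Fin R => l ∈ s) = s := by ext l; simp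
    rw [hfs, ← Finset.sum_attach, Finset.univ_eq_attach]
    refine Finset.sum_congr rfl fun i _ => ?_
    simp [hext, i.2]
  have hext_zero : ∀ g : ↥s → ℝ, (∃ t : Edge m → ℝ, X t = ∑ l, ext g l • Vf l) → g = 0 := by
    intro g ⟨t, ht⟩
    by_contra hg
    have hne : ext g ≠ 0 := by
      intro h0
      apply hg
      funext i
      have := congrFun h0 i.1
      simpa [hext, i.2] using this
    obtain ⟨Q, hQ, hneq⟩ := H (ext g) (hext_off g) hne t
    apply hneq
    have := congrFun ht ⟨Q, hQ⟩
    rw [hXapply, Finset.sum_apply] at this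
    refine Eq.trans ?_ this.symm
    exact Finset.sum_congr rfl fun l _ => by rw [Pi.smul_apply, smul_eq_mul]
  -- the family on `s` is linearly independent …
  set v : ↥s → ({Q : Finset (Fin m) // Q.card = k} → ℝ) := fun i => Vf i.1 with hv
  have hli : LinearIndependent ℝ v := by
    rw [Fintype.linearIndependent_iff]
    intro g hg i
    have h0 := hext_zero g ⟨0, by rw [map_zero, hext_sum, ← hg]⟩
    rw [h0]; rfl
  -- … and its span meets the column space trivially
  set B : Submodule ℝ ({Q : Finset (Fin m) // Q.card = k} → ℝ) := Submodule.span ℝ (Set.range v) with hB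
  have hinf : LinearMap.range X ⊓ B = ⊥ := by
    rw [Submodule.eq_bot_iff]
    intro x hx
    obtain ⟨hxA, hxB⟩ := Submodule.mem_inf.1 hx
    obtain ⟨g, hg⟩ := (Submodule.mem_span_range_iff_exists_fun ℝ).1 hxB
    obtain ⟨t, ht⟩ := LinearMap.mem_range.1 hxA
    have h0 := hext_zero g ⟨t, by rw [ht, hext_sum, ← hg]⟩
    rw [← hg, h0]
    simp
  have hBfr : Module.finrank ℝ B = p + 1 := by
    rw [hB, finrank_span_eq_card hli, Fintype.card_coe, hs]
  have hsup := Submodule.finrank_sup_add_finrank_inf_eq (LinearMap.range X) B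
  rw [hinf, finrank_bot, add_zero, hfr, hBfr] at hsup
  have hle : LinearMap.range X ⊔ B ≤ S := sup_le hrange (Submodule.span_le.2 (by
    rintro _ ⟨i, rfl⟩
    exact hVmem i.1))
  have := Submodule.finrank_mono hle
  omega

/-- **`R ≤ C(m,2) + p` terms ⟹ codimension defect `≤ p`** (the row objects span `≤ R` dimensions). [new] -/
theorem exists_relation_of_card_le {k R p : ℕ} (hk : 3 ≤ k) (hkm : k + 2 ≤ m) (ε : ℝ)
    (U : (Edge m → Bool) → Fin R → ℝ) (V : Fin R → Finset (Fin m) → ℝ)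
    (hfact : ∀ (Q : Finset (Fin m)) (u : Edge m → Bool), Q.card = k → cliqueFn m k u = false →
      cdist Q u - ε = ∑ l, U u l * V l Q)
    (hR : R ≤ m.choose 2 + p) (s : Finset (Fin R)) (hs : s.card = p + 1) :
    ∃ h : Fin R → ℝ, (∀ l, l ∉ s → h l = 0) ∧ h ≠ 0 ∧
      ∃ t : Edge m → ℝ, ∀ Q : Finset (Fin m), Q.card = k →
        ∑ l, h l * V l Q = ∑ e, (if cliqueVec Q e = true then t e else 0) := by
  refine exists_relation_of_finrank_le hk hkm ε U V hfact ?_ s hs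
  have h := finrank_range_le_card (R := ℝ) (fun l : Fin R => fun Q : {Q : Finset (Fin m) // Q.card = k} => V l Q.1)
  rw [Fintype.card_fin] at h
  exact (Submodule.finrank_mono le_rfl |>.trans h).trans hR

/-! ## Eventual forms -/

/-- **Codimension theorem (eventual form).** For every `δ ∈ (0,1/2)`, every `p` and every `c`: eventually in `m`
(`k = ⌈m^δ⌉₊`), for every `ε > 0` and every `R ≤ m^c`, there is NO non-negative factorisation
`cdist Q u − ε = ∑_{l<R} U_l(u) V_l(Q)` (all `k`-sets `Q`, all `k`-clique-free `u`) whose row objects have codimension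
defect `≤ p` over the column space (every `p+1` of them with a non-trivial combination that is a clique sum on `k`-sets). [new] -/
theorem lpSlice_codim_gt {δ : ℝ} (hδ0 : 0 < δ) (hδ1 : δ < 1 / 2) (p c : ℕ) :
    ∀ᶠ m : ℕ in atTop, ∀ ε : ℝ, 0 < ε → ∀ R : ℕ, R ≤ m ^ c →
      ∀ (U : (Edge m → Bool) → Fin R → ℝ) (V : Fin R → Finset (Fin m) → ℝ),
      (∀ u l, 0 ≤ U u l) → (∀ l (Q : Finset (Fin m)), Q.card = ⌈(m : ℝ) ^ δ⌉₊ → 0 ≤ V l Q) →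
      (∀ s : Finset (Fin R), s.card = p + 1 → ∃ h : Fin R → ℝ, (∀ l, l ∉ s → h l = 0) ∧ h ≠ 0 ∧
        ∃ t : Edge m → ℝ, ∀ Q : Finset (Fin m), Q.card = ⌈(m : ℝ) ^ δ⌉₊ →
          ∑ l, h l * V l Q = ∑ e, (if cliqueVec Q e = true then t e else 0)) →
      ¬ ∀ (Q : Finset (Fin m)) (u : Edge m → Bool), Q.card = ⌈(m : ℝ) ^ δ⌉₊ → cliqueFn m ⌈(m : ℝ) ^ δ⌉₊ u = false →
          cdist Q u - ε = ∑ l, U u l * V l Q := by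
  filter_upwards [eventually_catch_exponent_linear_var hδ0 hδ1 ((c + 1) * (p + 1)), eventually_ge_atTop 2]
    with m hm hm2
  obtain ⟨hkB, hkm, hsq, hsmall⟩ := hm
  intro ε hε R hR U V hU hV hP hall
  set k : ℕ := ⌈(m : ℝ) ^ δ⌉₊ with hk
  have hk4 : 4 ≤ k := by omega
  have hkm2 : k + 2 ≤ m := by nlinarith
  have hkR : (4 : ℝ) ≤ k := by exact_mod_cast hk4
  have hL1 : (1 : ℝ) ≤ 400 * (k : ℝ) - 1 := by nlinarith
  have hLq : (k : ℝ) - 1 ≤ 12 * (400 * (k : ℝ) - 1) := by nlinarith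
  set θ : ℝ := Real.exp (-(((k : ℝ) - 1) * ((m : ℝ) - 1) / (2304 * k * (400 * (k : ℝ) - 1) ^ 2))) +
    Real.exp (-(1 / (5200 * Real.sqrt (2 * (k : ℝ) * ((k : ℝ) - 2) / ((m : ℝ) - k - 1))))) with hθ
  have hlb := codim_terms_lower_bound_of_catch (by omega) hkm2 U V hU hV ε hε hall hP θ
    (fun w hw => by
      have h := card_badColourings_le_var hk4 hsq (400 * (k : ℝ) - 1) hL1 hLq
        (fun v hv => abs_sum_le_linear hk4 (by omega) v hv) w hw
      rw [hθ, mul_add]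
      exact h)
  have hθ0 : 0 < θ := by rw [hθ]; positivity
  have hq3 : (3 : ℝ) ≤ ((k - 1 : ℕ) : ℝ) := by
    have : 3 ≤ k - 1 := by omega
    exact_mod_cast this
  set qm : ℝ := ((k - 1 : ℕ) : ℝ) ^ m with hqm
  have hqm0 : 0 < qm := by rw [hqm]; positivity
  have hq_le : ((k - 1 : ℕ) : ℝ) ≤ qm / 2 := by
    obtain ⟨m', hm'⟩ : ∃ m', m = m' + 2 := ⟨m - 2, by omega⟩
    rw [hqm, hm', pow_succ, pow_succ]
    have h1 : (1 : ℝ) ≤ ((k - 1 : ℕ) : ℝ) ^ m' := one_le_pow₀ (by linarith)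
    have hQ0 : (0 : ℝ) ≤ ((k - 1 : ℕ) : ℝ) := by positivity
    have h2 := mul_le_mul h1 hq3 (by norm_num) (by positivity)
    have h3 := mul_le_mul_of_nonneg_right h2 hQ0
    linarith
  -- `(R+1)^{p+1} ≤ m^{(c+1)(p+1)}`
  have hm2R : (2 : ℝ) ≤ m := by exact_mod_cast hm2
  have hRpow : ((R : ℝ) + 1) ^ (p + 1) ≤ (m : ℝ) ^ ((c + 1) * (p + 1)) := by
    have hR' : (R : ℝ) ≤ (m : ℝ) ^ c := by exact_mod_cast hR
    have h1 : (R : ℝ) + 1 ≤ (m : ℝ) ^ (c + 1) := by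
      have hmc : (1 : ℝ) ≤ (m : ℝ) ^ c := one_le_pow₀ (by linarith)
      calc (R : ℝ) + 1 ≤ (m : ℝ) ^ c + (m : ℝ) ^ c := by linarith
        _ = 2 * (m : ℝ) ^ c := by ring
        _ ≤ (m : ℝ) * (m : ℝ) ^ c := mul_le_mul_of_nonneg_right hm2R (by positivity)
        _ = (m : ℝ) ^ (c + 1) := by ring
    calc ((R : ℝ) + 1) ^ (p + 1) ≤ ((m : ℝ) ^ (c + 1)) ^ (p + 1) := pow_le_pow_left₀ (by positivity) h1 _
      _ = (m : ℝ) ^ ((c + 1) * (p + 1)) := by rw [← pow_mul]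
  have hRθ : ((R : ℝ) + 1) ^ (p + 1) * (qm * θ) ≤ qm / 4 := by
    calc ((R : ℝ) + 1) ^ (p + 1) * (qm * θ) ≤ (m : ℝ) ^ ((c + 1) * (p + 1)) * (qm * θ) :=
          mul_le_mul_of_nonneg_right hRpow (by positivity)
      _ = qm * ((m : ℝ) ^ ((c + 1) * (p + 1)) * θ) := by ring
      _ ≤ qm * (1 / 4) := mul_le_mul_of_nonneg_left hsmall hqm0.le
      _ = qm / 4 := by ring
  linarith

/-- **ε-sensitivity costs more than any constant number of terms.** For every `δ ∈ (0, 1/2)` and every `p`: eventually in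
`m` (`k = ⌈m^δ⌉₊`), for every `ε > 0` and every `R ≤ C(m,2) + p`, there is NO non-negative factorisation
`cdist Q u − ε = ∑_{l<R} U_l(u) V_l(Q)` (`U ≥ 0`, `V_l ≥ 0` on `k`-sets) valid for all `k`-sets `Q` and all `k`-clique-free
`u`: `rk₊(D − εJ) > rk(D) + p = C(m,2) + p` for all `ε > 0` (session 13: `p = 0`). [new] -/
theorem lpSlice_terms_gt_choose_two_add {δ : ℝ} (hδ0 : 0 < δ) (hδ1 : δ < 1 / 2) (p : ℕ) :
    ∀ᶠ m : ℕ in atTop, ∀ ε : ℝ, 0 < ε → ∀ R : ℕ, R ≤ m.choose 2 + p →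
      ∀ (U : (Edge m → Bool) → Fin R → ℝ) (V : Fin R → Finset (Fin m) → ℝ),
      (∀ u l, 0 ≤ U u l) → (∀ l (Q : Finset (Fin m)), Q.card = ⌈(m : ℝ) ^ δ⌉₊ → 0 ≤ V l Q) →
      ¬ ∀ (Q : Finset (Fin m)) (u : Edge m → Bool), Q.card = ⌈(m : ℝ) ^ δ⌉₊ → cliqueFn m ⌈(m : ℝ) ^ δ⌉₊ u = false →
          cdist Q u - ε = ∑ l, U u l * V l Q := by
  filter_upwards [lpSlice_codim_gt hδ0 hδ1 p 3, eventually_catch_exponent_linear_var hδ0 hδ1 0,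
    eventually_ge_atTop p, eventually_ge_atTop 2] with m hcod hk hmp hm2
  obtain ⟨hk4, hkm, -⟩ := hk
  intro ε hε R hR U V hU hV hall
  have hkm2 : ⌈(m : ℝ) ^ δ⌉₊ + 2 ≤ m := by omega
  have hR3 : R ≤ m ^ 3 := by
    have h1 : m.choose 2 ≤ m ^ 2 := Nat.choose_le_pow m 2
    have h2 : m ^ 2 + m ≤ m ^ 3 := by
      have : m ^ 3 = m * m ^ 2 := by ring
      nlinarith
    omega
  exact hcod ε hε R hR3 U V hU hV
    (fun s hs => exists_relation_of_card_le (by omega) hkm2 ε U V hall hR s hs) hall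

/-- **Polynomial-size factorisations have factor rank `> C(m,2) + p`, every `p`.** For every `δ ∈ (0,1/2)`, every `p` and
every `c`: eventually in `m` (`k = ⌈m^δ⌉₊`), for every `ε > 0` and every `R ≤ m^c`, there is NO non-negative factorisation
`cdist Q u − ε = ∑_{l<R} U_l(u) V_l(Q)` (`U ≥ 0`, `V_l ≥ 0` on `k`-sets) whose row objects, restricted to `k`-sets, span at
most `C(m,2) + p = rank(D) + p` dimensions. In NMF terms: every polynomial-size NMF `D − εJ = UV` has
`rank(V) − rank(D − εJ) ≥ p` — it is far from RESTRICTED (Gillis–Glineur: `rank V = rank`). [new] -/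
theorem lpSlice_factorRank_gt {δ : ℝ} (hδ0 : 0 < δ) (hδ1 : δ < 1 / 2) (p c : ℕ) :
    ∀ᶠ m : ℕ in atTop, ∀ ε : ℝ, 0 < ε → ∀ R : ℕ, R ≤ m ^ c →
      ∀ (U : (Edge m → Bool) → Fin R → ℝ) (V : Fin R → Finset (Fin m) → ℝ),
      (∀ u l, 0 ≤ U u l) → (∀ l (Q : Finset (Fin m)), Q.card = ⌈(m : ℝ) ^ δ⌉₊ → 0 ≤ V l Q) →
      Module.finrank ℝ (Submodule.span ℝ (Set.range fun l : Fin R =>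
        fun Q : {Q : Finset (Fin m) // Q.card = ⌈(m : ℝ) ^ δ⌉₊} => V l Q.1)) ≤ m.choose 2 + p →
      ¬ ∀ (Q : Finset (Fin m)) (u : Edge m → Bool), Q.card = ⌈(m : ℝ) ^ δ⌉₊ → cliqueFn m ⌈(m : ℝ) ^ δ⌉₊ u = false →
          cdist Q u - ε = ∑ l, U u l * V l Q := by
  filter_upwards [lpSlice_codim_gt hδ0 hδ1 p c, eventually_catch_exponent_linear_var hδ0 hδ1 0] with m hcod hk
  obtain ⟨hk4, hkm, -⟩ := hk
  intro ε hε R hR U V hU hV hfr hall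
  have hkm2 : ⌈(m : ℝ) ^ δ⌉₊ + 2 ≤ m := by omega
  exact hcod ε hε R hR U V hU hV
    (fun s hs => exists_relation_of_finrank_le (by omega) hkm2 ε U V hall hfr s hs) hall

/-- **The same in the `ConeFactorisable` vocabulary of the strict-rank line** (`q = 0` PSD part, constant potential
`a ≡ ε`, `b ≡ 1`): for `δ ∈ (0,1/2)` and every `p`, eventually in `m`, for every `ε > 0` and every `r ≤ C(m,2) + p`,
`¬ ConeFactorisable m ⌈m^δ⌉₊ 0 r (fun _ => ε) (fun _ => 1)`. [new] -/
theorem not_coneFactorisable_le_choose_two_add {δ : ℝ} (hδ0 : 0 < δ) (hδ1 : δ < 1 / 2) (p : ℕ) :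
    ∀ᶠ m : ℕ in atTop, ∀ ε : ℝ, 0 < ε → ∀ r : ℕ, r ≤ m.choose 2 + p →
      ¬ Summit.PneNP.PneNP.Cruxes.ConvexGateBlind.StrictRankConicCover.ConeFactorisable m ⌈(m : ℝ) ^ δ⌉₊ 0 r
        (fun _ => ε) (fun _ => 1) := by
  filter_upwards [lpSlice_terms_gt_choose_two_add hδ0 hδ1 p] with m hm
  intro ε hε r hr hcf
  obtain ⟨H, Y, U, V, -, -, hU, hV, hall⟩ := hcf
  refine hm ε hε r hr U V hU (fun l Q _ => hV l Q) fun Q u hQ hu => ?_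
  have h := hall Q u hQ hu
  rw [Matrix.trace, Fintype.sum_empty, zero_add, mul_one] at h
  exact h

/-- **Codimension theorem** (registered form of `lpSlice_codim_gt`). [new] -/
theorem lpSlice_codimension : ∀ (δ : ℝ), 0 < δ → δ < 1 / 2 → ∀ p c : ℕ, ∀ᶠ m : ℕ in Filter.atTop, ∀ ε : ℝ, 0 < ε → ∀ R : ℕ, R ≤ m ^ c → ∀ (U : (Edge m → Bool) → Fin R → ℝ) (V : Fin R → Finset (Fin m) → ℝ), (∀ u l, 0 ≤ U u l) → (∀ l (Q : Finset (Fin m)), Q.card = ⌈(m : ℝ) ^ δ⌉₊ → 0 ≤ V l Q) → (∀ s : Finset (Fin R), s.card = p + 1 → ∃ h : Fin R → ℝ, (∀ l, l ∉ s → h l = 0) ∧ h ≠ 0 ∧ ∃ t : Edge m → ℝ, ∀ Q : Finset (Fin m), Q.card = ⌈(m : ℝ) ^ δ⌉₊ → ∑ l, h l * V l Q = ∑ e, (if cliqueVec Q e = true then t e else 0)) → ¬ ∀ (Q : Finset (Fin m)) (u : Edge m → Bool), Q.card = ⌈(m : ℝ) ^ δ⌉₊ → cliqueFn m ⌈(m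 : ℝ) ^ δ⌉₊ u = false → cdist Q u - ε = ∑ l, U u l * V l Q :=
  fun _ hδ0 hδ1 p c => lpSlice_codim_gt hδ0 hδ1 p c

/-- **Factor rank exceeds `C(m,2) + p`** (registered form of `lpSlice_factorRank_gt`). [new] -/
theorem lpSlice_factor_rank_plus : ∀ (δ : ℝ), 0 < δ → δ < 1 / 2 → ∀ p c : ℕ, ∀ᶠ m : ℕ in Filter.atTop, ∀ ε : ℝ, 0 < ε → ∀ R : ℕ, R ≤ m ^ c → ∀ (U : (Edge m → Bool) → Fin R → ℝ) (V : Fin R → Finset (Fin m) → ℝ), (∀ u l, 0 ≤ U u l) → (∀ l (Q : Finset (Fin m)), Q.card = ⌈(m : ℝ) ^ δ⌉₊ → 0 ≤ V l Q) → Module.finrank ℝ (Submodule.span ℝ (Set.range fun l : Fin R => fun Q : {Q : Finset (Fin m) // Q.card = ⌈(m : ℝ) ^ δ⌉₊} => V l Q.1)) ≤ m.choose 2 + p → ¬ ∀ (Q : Finset (Fin m)) (u : Edge m → Bool), Q.card = ⌈(m : ℝ) ^ δ⌉₊ → cliqueFn m ⌈(m : ℝ) ^ δ⌉₊ u = false →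 cdist Q u - ε = ∑ l, U u l * V l Q :=
  fun _ hδ0 hδ1 p c => lpSlice_factorRank_gt hδ0 hδ1 p c

/-- **ε-sensitivity costs more than any constant number of terms** (registered form of `lpSlice_terms_gt_choose_two_add`). [new] -/
theorem lpSlice_rank_plus : ∀ (δ : ℝ), 0 < δ → δ < 1 / 2 → ∀ p : ℕ, ∀ᶠ m : ℕ in Filter.atTop, ∀ ε : ℝ, 0 < ε → ∀ R : ℕ, R ≤ m.choose 2 + p → ∀ (U : (Edge m → Bool) → Fin R → ℝ) (V : Fin R → Finset (Fin m) → ℝ), (∀ u l, 0 ≤ U u l) → (∀ l (Q : Finset (Fin m)), Q.card = ⌈(m : ℝ) ^ δ⌉₊ → 0 ≤ V l Q) → ¬ ∀ (Q : Finset (Fin m)) (u : Edge m → Bool), Q.card = ⌈(m : ℝ) ^ δ⌉₊ → cliqueFn m ⌈(m : ℝ) ^ δ⌉₊ u = false → cdist Q u - ε = ∑ l, U u l * V l Q :=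
  fun _ hδ0 hδ1 p => lpSlice_terms_gt_choose_two_add hδ0 hδ1 p

end

end Summit.PneNP.PneNP.Theorems
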